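import Summits.CriticalPhenomena.SAWScalingLimit.Theorems.SAWLoopFugacityFlowAvoidanceLimitAnchorDefs
import Literature.Probability.LatticeModels.HoleFreePotential
import Literature.Probability.RandomPlanarGeometry.ChordalLERWScalingLimit
import HarnessLib

/-!
# Hole-freeness of the inner lattice approximant (given the escape property);
# the inner site graph is a subgraph of the confined graph
— helper of stub `stub_greenConvergence` (GC) of line `symplectic-fermion-anchor`
(crux `SAWLoopFugacityFlow.AvoidanceLimit`, stmt-CriticalPhenomena-10649; lead c2 GC-sandwich
programme, brick W-C2)

**What.** Fix Jordan domains `D' ⊆ D` and a mesh `δ > 0`. Call a site `w ∈ ℤ²` *good* when the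
closed `2δ`-ball around its mesh point `δw` lies in `D'`, let
`Inner = {y ∈ meshDomain D δ | y good}` be the inner approximant (the good sites of the discrete
domain `Ω_δ(D)`), `siteGraph Inner` its nearest-neighbour graph (`ChordalLERW.siteGraph`: all edges
of `ℤ²` with both endpoints in `Inner`), and `C = {x | (siteGraph Inner).Reachable b x}` the
component of a base point `b ∈ Inner`.

* `holeFree_innerComponent` (registered signature): GIVEN the escape property of the non-good sites
  (every non-good site is joined, through nearest-neighbour steps between non-good sites, to sites
  of arbitrarily large second coordinate — the neighbouring brick W-C1, taken here as a hypothesis),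
  the component `C` is hole-free in the sense of `HoleFree`
  (`Literature/Probability/LatticeModels/HoleFreePotential`).
* `siteGraph_inner_le_confinedGraph` (registered signature): `siteGraph Inner` is a subgraph of the
  confined graph `confinedGraph D D' δ` (the edges of `Ω_δ(D)` whose closed segment lies in
  `closure D'`): a nearest-neighbour edge issued from a good site has its closed segment inside the
  closed `2δ`-ball, hence inside `D' ⊆ D`.

**Proof of hole-freeness** (`holeFree_of_escape`, pure lattice combinatorics). Let `g ∉ C`,
`M ∈ ℤ`, and let `R` be the set of sites reached from `g` by face steps avoiding `C`; all of `R`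
lies outside `C`. If some site of `R` is not good, the escape hypothesis continues the chain through
non-good sites — which avoid `C ⊆ Inner ⊆ good` (`FaceStep.mono`) — up to height `M`. Otherwise,
if no site of `R` reached height `M`, take `x ∈ R` of maximal height (`Int.exists_greatest_of_bdd`)
and the site `y` above it: `y ∉ R`, so the step `x → y` is not a face step, forcing `y ∈ C`; but a
good site `ℤ²`-adjacent to a point of `C ⊆ meshDomain D δ` lies in the discrete domain (its mesh
edge is inside the ball, hence inside `D ⊆ closure D`, and `meshDomain` is a union of mesh
components), so `x ∈ Inner`, `y ∼ x` in `siteGraph Inner`, and `x ∈ C` — a contradiction.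

Sources: folklore lattice combinatorics; no definitions; nothing from the literature is asserted
here. The two helpers `dist_meshPoint_of_zdGraph_adj'`, `mem_meshDomain_of_meshGraph_adj'` are
adapted from `Literature/Probability/Percolation/BoxCrossingProofs` (not in the import cone).
-/

noncomputable section

open scoped BigOperators Topology
open Filter Finset
open Literature.Probability.RandomPlanarGeometry Literature.Probability.LatticeModels

namespace Summit.CriticalPhenomena.SAWScalingLimit.Theorems.AvoidanceLimit.Anchor

/-! ## Lattice geometry of one mesh edge -/

/-- Adjacent sites of `ℤ²` have mesh points at distance `|δ|`. [folklore] -/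
private theorem dist_meshPoint_of_zdGraph_adj' {δ : ℝ} {x y : Site 2} (h : (zdGraph 2).Adj x y) :
    dist (meshPoint δ x) (meshPoint δ y) = |δ| := by
  -- adapted from `Literature.Probability.Percolation.dist_meshPoint_of_adj` (BoxCrossingProofs)
  have key : ∀ (u : Site 2) (i : Fin 2),
      dist (meshPoint δ u) (meshPoint δ (u + Pi.single i 1)) = |δ| := by
    intro u i
    rw [Complex.dist_eq]
    have hre : (meshPoint δ u - meshPoint δ (u + Pi.single i 1)).re =
        -(δ * (Pi.single (M := fun _ : Fin 2 => ℤ) i (1 : ℤ) 0 : ℤ)) := by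
      simp only [Complex.sub_re, meshPoint_re, Pi.add_apply, Int.cast_add]; ring
    have him : (meshPoint δ u - meshPoint δ (u + Pi.single i 1)).im =
        -(δ * (Pi.single (M := fun _ : Fin 2 => ℤ) i (1 : ℤ) 1 : ℤ)) := by
      simp only [Complex.sub_im, meshPoint_im, Pi.add_apply, Int.cast_add]; ring
    rw [← Complex.re_add_im (meshPoint δ u - meshPoint δ (u + Pi.single i 1)), hre, him]
    fin_cases i
    · simp [Complex.norm_real]
    · simp
  obtain ⟨i, rfl | rfl⟩ := (zdGraph_adj_iff x y).1 h
  · exact key x i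
  · rw [dist_comm]; exact key y i

/-- For `δ > 0`, the closed mesh edge from `δx` to a nearest neighbour `δy` lies in the closed
`2δ`-ball around `δx` (it even lies in the closed `δ`-ball). [folklore] -/
private theorem segment_meshPoint_subset_closedBall {δ : ℝ} (hδ : 0 < δ) {x y : Site 2}
    (h : (zdGraph 2).Adj x y) :
    segment ℝ (meshPoint δ x) (meshPoint δ y) ⊆ Metric.closedBall (meshPoint δ x) (2 * δ) := by
  refine (convex_closedBall _ _).segment_subset (Metric.mem_closedBall_self (by positivity)) ?_
  rw [Metric.mem_closedBall, dist_comm, dist_meshPoint_of_zdGraph_adj' h, abs_of_pos hδ]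
  linarith

/-- The discrete domain `Ω_δ` (a union of whole connected components of the mesh graph on mesh
vertices) is closed under mesh-graph neighbours that are mesh vertices. [folklore] -/
private theorem mem_meshDomain_of_meshGraph_adj' {Ω : Set ℂ} {δ : ℝ} {x y : Site 2}
    (hx : x ∈ meshDomain Ω δ) (hy : y ∈ meshVertices Ω δ) (hxy : (meshGraph Ω δ).Adj x y) :
    y ∈ meshDomain Ω δ := by
  -- adapted from `Literature.Probability.Percolation.mem_meshDomain_of_meshGraph_adj`
  simp only [meshDomain, Set.mem_iUnion, Set.mem_image] at hx ⊢
  obtain ⟨C, hC, x', hx'C, rfl⟩ := hx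
  refine ⟨C, hC, ⟨y, hy⟩, ?_, rfl⟩
  rw [SimpleGraph.ConnectedComponent.mem_supp_iff] at hx'C ⊢
  rw [← hx'C]
  exact SimpleGraph.ConnectedComponent.sound
    (SimpleGraph.Adj.reachable (show (meshVertexGraph Ω δ).Adj ⟨y, hy⟩ x' from hxy.symm))

/-- A good site (closed `2δ`-ball around its mesh point inside `D' ⊆ D`, `δ > 0`) that is
`ℤ²`-adjacent to a point of the discrete domain `Ω_δ(D)` belongs to the discrete domain: its mesh
point lies in `D`, and the closed mesh edge lies in the ball, hence in `closure D`. [folklore] -/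
private theorem mem_meshDomain_of_closedBall_subset_of_adj {D D' : Set ℂ} {δ : ℝ} (hδ : 0 < δ)
    (hsub : D' ⊆ D) {x y : Site 2} (hx : Metric.closedBall (meshPoint δ x) (2 * δ) ⊆ D')
    (hy : y ∈ meshDomain D δ) (hxy : (zdGraph 2).Adj x y) : x ∈ meshDomain D δ := by
  refine mem_meshDomain_of_meshGraph_adj' hy ?_ ?_
  · exact mem_meshVertices_iff.2 (hsub (hx (Metric.mem_closedBall_self (by positivity))))
  · rw [meshGraph_adj_iff, segment_symm]
    exact ⟨hxy.symm,
      ((segment_meshPoint_subset_closedBall hδ hxy).trans hx).trans (hsub.trans subset_closure)⟩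

/-! ## Hole-freeness from the escape property: the combinatorial core -/

/-- A point that is `siteGraph A`-reachable from a point of `A` lies in `A` (the last dart of a
walk of positive length ends in `A`). [folklore] -/
private theorem mem_of_siteGraph_reachable {A : Set (Site 2)} {b x : Site 2} (hb : b ∈ A)
    (h : (ChordalLERW.siteGraph A).Reachable b x) : x ∈ A := by
  obtain ⟨w⟩ := h.symm
  cases w with
  | nil => exact hb
  | cons hadj _ => exact (ChordalLERW.siteGraph_adj_iff.1 hadj).2.1

/-- A chain of face steps avoiding `P` that starts outside `P` ends outside `P`. [folklore] -/
private theorem not_mem_of_reflTransGen_faceStep {P : Set (Site 2)} {g y : Site 2}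
    (h : Relation.ReflTransGen (FaceStep P) g y) (hg : g ∉ P) : y ∉ P := by
  induction h with
  | refl => exact hg
  | tail _ hs _ => exact hs.2.2

/-- **Hole-freeness from escape, abstractly.** Let `C ⊆ Good ⊆ ℤ²`. Suppose that every non-good
site is joined through face steps avoiding `Good` to sites of arbitrarily large second coordinate,
and that a good site whose upper neighbour lies in `C` lies in `C` itself. Then `C` is hole-free:
from `g ∉ C`, either the sites reached by face steps avoiding `C` contain a non-good one (escape
through non-good sites, which avoid `C`), or they are all good, and then they are unbounded in
height — else the upper neighbour `y` of one of them of maximal height, `x`, is not reached, so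
`y ∈ C`, so `x ∈ C`, absurd. [folklore] -/
private theorem holeFree_of_escape {Good C : Set (Site 2)} (hCG : C ⊆ Good)
    (hesc : ∀ x : Site 2, x ∉ Good → ∀ M : ℤ, ∃ g' : Site 2, M ≤ g' 1 ∧
      Relation.ReflTransGen (FaceStep Good) x g')
    (hup : ∀ x : Site 2, x ∈ Good → x + Pi.single 1 1 ∈ C → x ∈ C) : HoleFree C := by
  intro g hg M
  by_cases hall : ∀ y : Site 2, Relation.ReflTransGen (FaceStep C) g y → y ∈ Good
  · -- every site reached from `g` is good: the reached set is unbounded in height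
    by_contra hcon
    push Not at hcon
    have hbd : ∀ y : Site 2, Relation.ReflTransGen (FaceStep C) g y → y 1 ≤ M :=
      fun y hyR => (not_le.1 fun hle => hcon y hle hyR).le
    obtain ⟨h₀, ⟨x, hxR, hxh⟩, hmax⟩ := Int.exists_greatest_of_bdd
      (P := fun h : ℤ => ∃ y : Site 2, Relation.ReflTransGen (FaceStep C) g y ∧ y 1 = h)
      ⟨M, fun h ⟨y, hyR, hyh⟩ => hyh ▸ hbd y hyR⟩ ⟨g 1, g, Relation.ReflTransGen.refl, rfl⟩
    have hxC : x ∉ C := not_mem_of_reflTransGen_faceStep hxR hg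
    have hadj : (zdGraph 2).Adj x (x + Pi.single 1 1) := (zdGraph_adj_iff _ _).2 ⟨1, Or.inl rfl⟩
    have hyC : x + Pi.single 1 1 ∈ C := by
      by_contra hyC
      have h1 := hmax _ ⟨x + Pi.single 1 1, hxR.tail ⟨hadj, hxC, hyC⟩, rfl⟩
      simp only [Pi.add_apply, Pi.single_eq_same] at h1
      omega
    exact hxC (hup x (hall x hxR) hyC)
  · -- some site reached from `g` is not good: escape through non-good sites
    push Not at hall
    obtain ⟨x, hxR, hxG⟩ := hall
    obtain ⟨g', hM, hpath⟩ := hesc x hxG M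
    exact ⟨g', hM, hxR.trans
      (Relation.ReflTransGen.mono (fun a a' h => FaceStep.mono hCG h) _ _ hpath)⟩

/-! ## The two registered statements -/

/-- **Hole-freeness of the inner component, given the escape property** (registered signature,
GC-sandwich brick W-C2). With `Inner = {y ∈ meshDomain D δ | closedBall (δy) (2δ) ⊆ D'}` and `C`
the `siteGraph Inner`-component of a base point `b ∈ Inner`: if every site whose closed `2δ`-ball
is not inside `D'` escapes to arbitrarily large height through such sites, then `C` is hole-free.
Instance of `holeFree_of_escape` with `Good = {w | closedBall (δw) (2δ) ⊆ D'} ⊇ Inner ⊇ C`; the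
upward closure holds because a good site below a point of `C ⊆ meshDomain D δ` lies in the
discrete domain (`mem_meshDomain_of_closedBall_subset_of_adj`), hence in `Inner`, hence is joined
to that point in `siteGraph Inner`. [folklore] -/
theorem holeFree_innerComponent :
    ∀ (D D' : JordanDomain) (δ : ℝ) (b : Site 2), 0 < δ → D'.carrier ⊆ D.carrier →
      (∀ x : Site 2, ¬ (Metric.closedBall (meshPoint δ x) (2 * δ) ⊆ D'.carrier) → ∀ M : ℤ, ∃ g' : Site 2, M ≤ g' 1 ∧
        Relation.ReflTransGen (FaceStep {w : Site 2 | Metric.closedBall (meshPoint δ w) (2 * δ) ⊆ D'.carrier}) x g') →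
      b ∈ meshDomain D.carrier δ → Metric.closedBall (meshPoint δ b) (2 * δ) ⊆ D'.carrier →
      HoleFree {x : Site 2 | (ChordalLERW.siteGraph {y : Site 2 | y ∈ meshDomain D.carrier δ ∧
        Metric.closedBall (meshPoint δ y) (2 * δ) ⊆ D'.carrier}).Reachable b x} := by
  intro D D' δ b hδ hsub hesc hbD hbG
  have hbI : b ∈ {y : Site 2 | y ∈ meshDomain D.carrier δ ∧
      Metric.closedBall (meshPoint δ y) (2 * δ) ⊆ D'.carrier} := ⟨hbD, hbG⟩
  refine holeFree_of_escape
    (Good := {w : Site 2 | Metric.closedBall (meshPoint δ w) (2 * δ) ⊆ D'.carrier})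
    (fun x hx => (mem_of_siteGraph_reachable hbI hx).2) hesc ?_
  intro x hxG hyC
  have hyI := mem_of_siteGraph_reachable hbI hyC
  have hadj : (zdGraph 2).Adj x (x + Pi.single 1 1) := (zdGraph_adj_iff _ _).2 ⟨1, Or.inl rfl⟩
  have hxD : x ∈ meshDomain D.carrier δ :=
    mem_meshDomain_of_closedBall_subset_of_adj hδ hsub hxG hyI.1 hadj
  exact hyC.trans (ChordalLERW.siteGraph_adj_iff.2 ⟨hadj.symm, hyI, hxD, hxG⟩).reachable

/-- **The inner site graph is a subgraph of the confined graph** (registered signature,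
GC-sandwich brick W-C2): an edge of `siteGraph Inner` is an edge of `Ω_δ(D)` (both endpoints in
`meshDomain D δ`, closed segment inside the `2δ`-ball of a good endpoint, hence inside
`D' ⊆ D ⊆ closure D`) whose closed segment lies in `D' ⊆ closure D'`. [folklore] -/
theorem siteGraph_inner_le_confinedGraph :
    ∀ (D D' : JordanDomain) (δ : ℝ), 0 < δ → D'.carrier ⊆ D.carrier →
      ChordalLERW.siteGraph {y : Site 2 | y ∈ meshDomain D.carrier δ ∧
        Metric.closedBall (meshPoint δ y) (2 * δ) ⊆ D'.carrier} ≤ confinedGraph D.carrier D'.carrier δ := by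
  intro D D' δ hδ hsub x y hxy
  obtain ⟨hzd, hx, hy⟩ := ChordalLERW.siteGraph_adj_iff.1 hxy
  have hseg : segment ℝ (meshPoint δ x) (meshPoint δ y) ⊆ D'.carrier :=
    (segment_meshPoint_subset_closedBall hδ hzd).trans hx.2
  rw [confinedGraph, SimpleGraph.fromRel_adj]
  refine ⟨hzd.ne, Or.inl ⟨?_, hseg.trans subset_closure⟩⟩
  rw [discreteDomainGraph_adj_iff, meshGraph_adj_iff]
  exact ⟨⟨hzd, hseg.trans (hsub.trans subset_closure)⟩, hx.1, hy.1⟩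

end Summit.CriticalPhenomena.SAWScalingLimit.Theorems.AvoidanceLimit.Anchor

end
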